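import Mathlib
import HarnessLib.Audit
import Literature.Analysis.FluidPDE.NSWave0
import HarnessLib

/-!
# NavierStokesExistenceSmoothPeriodic — CONJECTURE (obligation of NavierStokesRegularity/NavierStokesRegularity)

Unproven conjecture migrated by the gate from `Literature/Analysis/FluidPDE/NSWave0.lean` (`Literature.Analysis.FluidPDE.NavierStokesExistenceSmoothPeriodic`): unproven conjectures are obligations of our
theories, not literature facts (human ruling 2026-08-15). Provenance: FeffermanClay2006. Routes use it as a crux item or via
`--conditional-bridge --conditional-on NavierStokesExistenceSmoothPeriodic`; a proof goes in the sibling `Theorems/NavierStokesExistenceSmoothPeriodicHolds.lean` as `theorem NavierStokesExistenceSmoothPeriodic_holds : NavierStokesExistenceSmoothPeriodic` so this file stays a conjecture LEAF that Literature/ may import.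
-/

namespace Summit.NavierStokesRegularity.NavierStokesRegularity

open Literature Literature.Analysis Literature.Analysis.FluidPDE
open scoped ContDiff ENNReal
open Laplacian MeasureTheory
local notation "ℝ³" => EuclideanSpace ℝ (Fin 3)

/-- OPEN CONJECTURE — **ns.S02**, Clay Millennium statement (B): existence and smoothness of
Navier–Stokes solutions in `ℝ³/ℤ³`, posed by C. Fefferman in the official Clay Mathematics
Institute problem description [cite: FeffermanClay2006, statement (B) with (8) (10) (11)]
[status: open] — it is the Millennium problem itself (the source asks for a proof of one of
(A)–(D)); no proof or disproof exists, so no `_holds` theorem can: never assert it, take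
`(h : NavierStokesExistenceSmoothPeriodic)` as an explicit hypothesis.
Statement (as printed, 2006): for every `ν > 0` and every smooth, divergence-free, `ℤ³`-periodic
`u₀ : ℝ³ → ℝ³` there are `u`, `p`, smooth on `ℝ³ × [0,∞)`, solving (1), (2), (3) with `f ≡ 0` and
datum `u₀`, with `u(·, t)` `ℤ³`-periodic for all `t ≥ 0` ((10) as printed constrains `u` only;
the CMI errata reading, which also asks `p(·, t)` periodic, implies this one:
`NavierStokesExistenceSmoothPeriodic.of_pressurePeriodic`). Verdict clean-up 2026-08-15: audited
faithful to the printed text, open problem; name and statement unchanged. -/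
@[conjecture] def NavierStokesExistenceSmoothPeriodic : Prop :=
  ∀ ν : ℝ, 0 < ν → ∀ u₀ : ℝ³ → ℝ³, ContDiff ℝ ∞ u₀ → NSWave0.IsDivFree u₀ → IsLatticePeriodic u₀ →
    ∃ (u : ℝ → ℝ³ → ℝ³) (p : ℝ → ℝ³ → ℝ),
      IsSmoothOnHalfSpace u ∧ IsSmoothOnHalfSpace p ∧
        IsNavierStokesSolution ν 0 u₀ u p ∧ ∀ t, 0 ≤ t → IsLatticePeriodic (u t)

end Summit.NavierStokesRegularity.NavierStokesRegularity
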